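import Literature.NumberTheory.NumberFields.CMFieldNormCokernelExponentTwo
import Literature.NumberTheory.NumberFields.RelNormGaloisProduct
import Literature.NumberTheory.NumberFields.ClassGroupNormIndex
import Literature.NumberTheory.NumberFields.CMFieldCapitulationKernel
import HarnessLib

/-!
# Inclusion of CM fields of odd relative degree: `[L : K]` odd ⟹ `h⁻_K ∣ h⁻_L`
# (Okazaki, *Acta Arith.* 92 (2000), §5 Corollary 29)

Topic `NumberTheory/NumberFields`; namespace `Literature.NumberTheory.NumberFields`.  Theorem-only file
(no definition, no named fact, no `sorry`), unconditional.  Sequel of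
`CMFieldNormCokernelExponentTwo.lean` (Okazaki's Prop. 27 for every pair of CM fields `K ⊆ L`: the
fourth power of every class in `A_K := ker N_{K/K⁺}` is a norm from `A_L := ker N_{L/L⁺}`) and of
`RelNormGaloisProduct.lean` (`𝔄 · σ𝔄 = N(𝔄)𝓞` in a quadratic extension).

> Okazaki, §5, **Corollary 29.** "Let `k ⊂ K` be two CM-fields.  Assume that `[K : k]` is odd.  Then
> `h⁻_k ∣ h⁻_K`.  *Proof.* This is a slight generalization of Proposition 4 of [12].  Here we give a
> completely different proof, which is independent of normality of `K/k`.  Since `[K : k]` is odd,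
> `N : C_K/ιC_{K⁺} → C_k/ιC_{k⁺}` is surjective by Proposition 27 and class field theory.  On the other
> hand, `κ_k = κ_K` by Lemma 16.  Thus, we get the assertion by (4)."  (§1: "`h⁻_F = h_F/h_{F⁺}` is called
> the relative class number of `F`"; (4): "`h⁻_F = #(C_F/ιC_{F⁺})/κ_F`".)

We write `(K, L)` for Okazaki's `(k, K)`.  The statement proved is Corollary 29 exactly as printed, for
EVERY pair of CM fields `K ⊆ L` of odd relative degree.  The proof is a variant of Okazaki's which stays
inside the kernels `A_F = ker(N : C_F → C_{F⁺})` (`#A_F = h⁻_F`, tree `IsCMField.classNumber_div_eq_card_ker`)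
instead of the quotients `C_F/ιC_{F⁺}` — so that neither the capitulation kernels `κ` (his Lemma 16) nor
formula (4) are needed:

1. (§1) **base change of the relative norm along the CM square** `K⁺ ⊆ K`, `L⁺ ⊆ L`, `K ⊆ L`: for an ideal
   `𝔞` of `𝓞_K`, `N_{L/L⁺}(𝔞𝓞_L)𝓞_L = (N_{K/K⁺}(𝔞)𝓞_K)𝓞_L` (both sides are `𝔞𝓞_L · \overline{𝔞𝓞_L}` by
   Neukirch (1.6)(iv) in the two quadratic layers, the complex conjugation of `L` restricting to that of
   `K`); hence **`ι_{L/K}(A_K) ⊆ A_L`** (`IsCMField.map_ker_le_ker_classGroupNorm`); and `N_{L/K}(A_L) ⊆ A_K`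
   (transitivity of norms around the square);
2. (§2) for `c ∈ A_K`: `c^{[L:K]} = N_{L/K}(ι_{L/K} c) ∈ N_{L/K}(A_L)` (Neukirch (1.6)(ii), tree
   `classGroupNorm_classGroupExtend`) and `c⁴ ∈ N_{L/K}(A_L)` (Prop. 27, tree
   `IsCMField.pow_four_mem_map_ker_classGroupNorm`); for `[L : K]` odd, `gcd([L:K], 4) = 1` and Bézout give
   `c ∈ N_{L/K}(A_L)`: **`N_{L/K}(A_L) = A_K`**, so `#A_K ∣ #A_L`, i.e. **`h⁻_K ∣ h⁻_L`** (Cor. 29);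
3. (§3) Okazaki's own intermediate statements: `Cl_K = N_{L/K}(Cl_L)·ι(Cl_{K⁺})` for `[L : K]` odd
   (Prop. 27 + the norm index theorem, tree `index_range_classGroupNorm_dvd_finrank`) formula (4)
   `[Cl_F : ι(Cl_{F⁺})] = h⁻_F κ_F`, and Lemma 14's `κ_F Q_F ∣ 2` (Washington Thm. 10.3, tree
   `CMFieldCapitulationKernel.lean`);
4. (§4) consequences: an imaginary quadratic field `K` inside a CM field `L` with `[L : K]` odd has
   `h_K ∣ h⁻_L` (no parity hypothesis on `h_K`); cyclotomic towers `ℚ(ζ_m) ⊆ ℚ(ζ_n)` of odd relative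
   degree, in particular **`h⁻(ℚ(ζ_p)) ∣ h⁻(ℚ(ζ_{p^{k+1}}))`** for an odd prime `p`.

## Main results (`K L : Type` CM number fields, `L` a `K`-algebra, `K⁺ = maximalRealSubfield K`)

* `IsCMField.map_relNorm_map_eq` — `N_{L/L⁺}(𝔞𝓞_L)𝓞_L = N_{K/K⁺}(𝔞)𝓞_L` for ideals `𝔞 ⊆ 𝓞_K`.
* `IsCMField.map_ker_le_ker_classGroupNorm` — **`ι_{L/K}(ker N_{K/K⁺}) ⊆ ker N_{L/L⁺}`**;
  `IsCMField.map_ker_classGroupNorm_le_ker` — `N_{L/K}(ker N_{L/L⁺}) ⊆ ker N_{K/K⁺}`.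
* `IsCMField.pow_finrank_mem_map_ker_classGroupNorm` — `c ∈ ker N_{K/K⁺} ⟹ c^{[L:K]} ∈ N_{L/K}(ker N_{L/L⁺})`.
* `IsCMField.ker_le_map_ker_classGroupNorm_of_odd`, `IsCMField.map_ker_classGroupNorm_eq_ker_of_odd` — `[L:K]` odd ⟹
  `N_{L/K}(ker N_{L/L⁺}) = ker N_{K/K⁺}` (the norm map `A_L → A_K` is onto).
* **`IsCMField.classNumber_div_dvd_classNumber_div_of_odd_finrank`** — **Cor. 29: `[L : K]` odd ⟹
  `h_K/h_{K⁺} ∣ h_L/h_{L⁺}`** (and `IsCMField.card_ker_dvd_card_ker_of_odd_finrank`, the same for `#ker`).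
* `IsCMField.range_sup_range_eq_top_of_odd` — `[L : K]` odd ⟹ `Cl_K = N_{L/K}(Cl_L) · ι(Cl_{K⁺})`
  (Okazaki's «N : C_K/ιC_{K⁺} → C_k/ιC_{k⁺} is surjective by Proposition 27 and class field theory»).
* `index_range_classGroupExtend_mul_classNumber`, `IsCMField.index_range_classGroupExtend_eq` — formula
  (4): `[Cl_K : ι(Cl_{K⁺})] = h⁻_K · κ_K`; `IsCMField.card_ker_classGroupExtend_mul_indexRealUnits_dvd_two` —
  Lemma 14 (first assertion) `κ_K · Q_K ∣ 2`; `h⁻_K ∣ [Cl_K : ι(Cl_{K⁺})] ∣ 2 h⁻_K`.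
* `IsCMField.classNumber_dvd_classNumber_div_of_finrank_eq_two_of_odd_finrank` — `[K : ℚ] = 2`,
  `[L : K]` odd ⟹ `h_K ∣ h_L/h_{L⁺}`.
* `classNumber_div_dvd_of_isCyclotomicExtension_of_odd_finrank`,
  `classNumber_div_dvd_of_isCyclotomicExtension_prime_pow` — cyclotomic towers.

Honest column: Okazaki's route through `coker(N : C_K/ιC_{K⁺} → C_k/ιC_{k⁺})`, `κ_k = κ_K` (Lemma 16)
and (4) is NOT followed to the end — the surjectivity `C_k = N(C_K)·ιC_{k⁺}` and (4) are proved (§3), but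
the last step «κ_k = κ_K by Lemma 16 … by (4)» is not taken here (Lemma 16 for odd degree is the
companion file `CMFieldCapitulationKernelOddDegree.lean` — `κ` — and the discharged fact
`Lemmermeyer1995_unitIndex_eq_of_odd_degree` of `HasseUnitIndexOddDegree.lean` — `Q`; the map
`C_L/ιC_{L⁺} → C_K/ιC_{K⁺}` itself needs the algebra `K⁺ → L⁺` in its statement); Cor. 29 is reached
through `A_K ⊆ N(A_L)` (§2) instead.  The
algebra `K⁺ → L⁺` (restriction of `K → L`) is not an instance of the tree; it is built locally inside the
proof of `N_{L/K}(A_L) ⊆ A_K` and appears in no statement.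

## References

* R. Okazaki, *Inclusion of CM-fields and divisibility of relative class numbers*, Acta Arith. 92 (2000)
  319–338, §1, §5 Prop. 27 and Cor. 29 (held `paper:doi-10-4064-aa-92-4-319-338`, pp. 13–14). [Okazaki2000]
* J. Neukirch, *Algebraic Number Theory*, Grundlehren 322 (1999), Ch. III §1 Prop. (1.6) (ii), (iv).
  [NeukirchANT1999]
* L. C. Washington, *Introduction to Cyclotomic Fields*, 2nd ed., GTM 83 (1997), Thm. 4.10, §10.1.
  [Washington1997]
-/

noncomputable section

open NumberField NumberField.IsCMField IsDedekindDomain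
open scoped nonZeroDivisors

namespace Literature.NumberTheory.NumberFields

/-! ### §1. Base change of `N` along the CM square; `ι_{L/K}(ker N_{K/K⁺}) ⊆ ker N_{L/L⁺}` -/

section BaseChange

variable (K L : Type) [Field K] [NumberField K] [IsCMField K] [Field L] [NumberField L] [IsCMField L]
  [Algebra K L]

/-- On integers the complex conjugations are compatible with `𝓞 K → 𝓞 L`:
`\bar{·}_L ∘ i = i ∘ \bar{·}_K`. [folklore] -/
private theorem conj_comp_algebraMap_int :
    (RingOfIntegers.mapAlgEquiv (complexConj L) : 𝓞 L →+* 𝓞 L).comp (algebraMap (𝓞 K) (𝓞 L)) =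
      (algebraMap (𝓞 K) (𝓞 L)).comp (RingOfIntegers.mapAlgEquiv (complexConj K) : 𝓞 K →+* 𝓞 K) := by
  ext x
  change complexConj L (algebraMap K L (x : K)) = algebraMap K L (complexConj K (x : K))
  exact (algebraMap_complexConj (x : K)).symm

/-- **`N_{L/L⁺}(𝔞𝓞_L)𝓞_L = (N_{K/K⁺}(𝔞)𝓞_K)𝓞_L`** for an ideal `𝔞` of `𝓞_K`, `K ⊆ L` CM fields: both
sides equal `𝔞𝓞_L · \overline{𝔞𝓞_L}` (`𝔄 · σ𝔄 = N(𝔄)𝓞` in the quadratic layers `L/L⁺` and `K/K⁺`, the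
complex conjugation of `L` restricting to that of `K`).
[cite: NeukirchANT1999, Ch. III §1 Prop. (1.6) (iv)] [cite: Okazaki2000, §2 Lemma 12, Remark («the restriction to k of the complex conjugation K is the complex conjugation of k»)] -/
theorem IsCMField.map_relNorm_map_eq (J : Ideal (𝓞 K)) :
    (Ideal.relNorm (𝓞 (maximalRealSubfield L)) (J.map (algebraMap (𝓞 K) (𝓞 L)))).map
        (algebraMap (𝓞 (maximalRealSubfield L)) (𝓞 L)) =
      ((Ideal.relNorm (𝓞 (maximalRealSubfield K)) J).map
        (algebraMap (𝓞 (maximalRealSubfield K)) (𝓞 K))).map (algebraMap (𝓞 K) (𝓞 L)) := by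
  have h2K : Module.finrank (maximalRealSubfield K) K = 2 :=
    Algebra.IsQuadraticExtension.finrank_eq_two (maximalRealSubfield K) K
  have h2L : Module.finrank (maximalRealSubfield L) L = 2 :=
    Algebra.IsQuadraticExtension.finrank_eq_two (maximalRealSubfield L) L
  rw [← NumberField.mul_map_eq_map_relNorm_of_finrank_eq_two (maximalRealSubfield L) L h2L
      (complexConj L) (complexConj_ne_one L),
    ← NumberField.mul_map_eq_map_relNorm_of_finrank_eq_two (maximalRealSubfield K) K h2K
      (complexConj K) (complexConj_ne_one K) J,
    Ideal.map_mul, ← Ideal.map_coe (RingOfIntegers.mapAlgEquiv (complexConj L)),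
    ← Ideal.map_coe (RingOfIntegers.mapAlgEquiv (complexConj K)), Ideal.map_map, Ideal.map_map,
    conj_comp_algebraMap_int K L]

omit [IsCMField L] [Algebra K L] in
/-- Extension of ideals `𝓞 L⁺ → 𝓞 L` is injective (Dedekind domains). [folklore] -/
private theorem ideal_map_injective :
    Function.Injective
      (Ideal.map (algebraMap (𝓞 (maximalRealSubfield L)) (𝓞 L)) :
        Ideal (𝓞 (maximalRealSubfield L)) → Ideal (𝓞 L)) := by
  intro I J h
  have hinj := FractionalIdeal.extendedHom_injective (𝓞 (maximalRealSubfield L)) (maximalRealSubfield L)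
    (L := L) (B := 𝓞 L)
  have h' : FractionalIdeal.extendedHom L (𝓞 L)
      ((I : FractionalIdeal (𝓞 (maximalRealSubfield L))⁰ (maximalRealSubfield L))) =
      FractionalIdeal.extendedHom L (𝓞 L)
      ((J : FractionalIdeal (𝓞 (maximalRealSubfield L))⁰ (maximalRealSubfield L))) := by
    rw [FractionalIdeal.extendedHom_coeIdeal_eq_map, FractionalIdeal.extendedHom_coeIdeal_eq_map, h]
  exact FractionalIdeal.coeIdeal_injective (hinj h')

/-- An element of `𝓞 K⁺`, pushed to `𝓞 L`, comes from `𝓞 L⁺`. [folklore] -/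
private theorem exists_algebraMap_eq (a : 𝓞 (maximalRealSubfield K)) :
    ∃ a' : 𝓞 (maximalRealSubfield L), algebraMap (𝓞 (maximalRealSubfield L)) (𝓞 L) a' =
      algebraMap (𝓞 K) (𝓞 L) (algebraMap (𝓞 (maximalRealSubfield K)) (𝓞 K) a) := by
  have h : ringOfIntegersComplexConj L
      (algebraMap (𝓞 K) (𝓞 L) (algebraMap (𝓞 (maximalRealSubfield K)) (𝓞 K) a)) =
        algebraMap (𝓞 K) (𝓞 L) (algebraMap (𝓞 (maximalRealSubfield K)) (𝓞 K) a) := by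
    apply RingOfIntegers.ext
    change complexConj L (algebraMap K L (((a : 𝓞 (maximalRealSubfield K)) :
        maximalRealSubfield K) : K)) =
      algebraMap K L (((a : 𝓞 (maximalRealSubfield K)) : maximalRealSubfield K) : K)
    rw [← algebraMap_complexConj, complexConj_apply_eq_self]
  exact (ringOfIntegersComplexConj_eq_self_iff L _).mp h

/-- **`ι_{L/K}(ker N_{K/K⁺}) ⊆ ker N_{L/L⁺}`** for CM fields `K ⊆ L`: if `N_{K/K⁺}(𝔞) = (a)` is principal
then `N_{L/L⁺}(𝔞𝓞_L) = (a)` is principal (§1 base change and injectivity of `𝔟 ↦ 𝔟𝓞_L`).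
[cite: Okazaki2000, §5, proof of Cor. 29] [cite: NeukirchANT1999, Ch. III §1 Prop. (1.6) (iv)] -/
theorem IsCMField.map_ker_le_ker_classGroupNorm :
    ((classGroupNorm (maximalRealSubfield K) K).ker).map (classGroupExtend K L) ≤
      (classGroupNorm (maximalRealSubfield L) L).ker := by
  intro x hx
  obtain ⟨c, hc, rfl⟩ := Subgroup.mem_map.mp hx
  obtain ⟨J, rfl⟩ := ClassGroup.mk0_surjective c
  rw [MonoidHom.mem_ker, classGroupNorm_mk0, ClassGroup.mk0_eq_one_iff] at hc
  rw [MonoidHom.mem_ker, classGroupExtend_mk0, classGroupNorm_mk0, ClassGroup.mk0_eq_one_iff]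
  obtain ⟨a, ha⟩ := (Submodule.isPrincipal_iff _).mp hc
  have ha' : Ideal.relNorm (𝓞 (maximalRealSubfield K)) (J : Ideal (𝓞 K)) = Ideal.span {a} := ha
  obtain ⟨a', ha'L⟩ := exists_algebraMap_eq K L a
  have key : Ideal.relNorm (𝓞 (maximalRealSubfield L))
      ((J : Ideal (𝓞 K)).map (algebraMap (𝓞 K) (𝓞 L))) = Ideal.span {a'} := by
    apply ideal_map_injective L
    rw [IsCMField.map_relNorm_map_eq K L, ha', Ideal.map_span, Set.image_singleton, Ideal.map_span,
      Set.image_singleton, Ideal.map_span, Set.image_singleton, ha'L]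
  exact (Submodule.isPrincipal_iff _).mpr ⟨a', key⟩

/-- Elementwise form: `N_{K/K⁺} c = 1 ⟹ N_{L/L⁺}(ι_{L/K} c) = 1`.
[cite: Okazaki2000, §5, proof of Cor. 29] -/
theorem IsCMField.classGroupNorm_classGroupExtend_eq_one {c : ClassGroup (𝓞 K)}
    (hc : classGroupNorm (maximalRealSubfield K) K c = 1) :
    classGroupNorm (maximalRealSubfield L) L (classGroupExtend K L c) = 1 :=
  IsCMField.map_ker_le_ker_classGroupNorm K L ⟨c, hc, rfl⟩

/-- **`N_{L/K}(ker N_{L/L⁺}) ⊆ ker N_{K/K⁺}`** for CM fields `K ⊆ L` (transitivity of norms around the square: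
`N_{K/K⁺} ∘ N_{L/K} = N_{L/K⁺} = N_{L⁺/K⁺} ∘ N_{L/L⁺}`, the algebra `K⁺ → L⁺` being the restriction of `K → L`).
Sharpens `IsCMField.conj_smul_classGroupNorm_eq_inv` («`N(A_L) ⊆ C_K⁻`»).
[cite: Okazaki2000, §5, proof of Cor. 29] [cite: NeukirchANT1999, Ch. III §1 Prop. (1.6) (i)] -/
theorem IsCMField.map_ker_classGroupNorm_le_ker :
    ((classGroupNorm (maximalRealSubfield L) L).ker).map (classGroupNorm K L) ≤
      (classGroupNorm (maximalRealSubfield K) K).ker := by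
  intro x hx
  obtain ⟨d, hd, rfl⟩ := Subgroup.mem_map.mp hx
  rw [MonoidHom.mem_ker] at hd
  rw [MonoidHom.mem_ker, classGroupNorm_classGroupNorm (maximalRealSubfield K) K L d]
  -- the algebra `K⁺ → L⁺` (restriction of `K → L`) and the tower `K⁺ → L⁺ → L`
  let f : maximalRealSubfield K →+* maximalRealSubfield L :=
    ((algebraMap K L).comp (maximalRealSubfield K).subtype).codRestrict (maximalRealSubfield L)
      (fun y => by
        rw [← complexConj_eq_self_iff, RingHom.comp_apply, Subfield.coe_subtype, ← algebraMap_complexConj,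
          complexConj_apply_eq_self])
  letI : Algebra (maximalRealSubfield K) (maximalRealSubfield L) := f.toAlgebra
  haveI : IsScalarTower (maximalRealSubfield K) (maximalRealSubfield L) L :=
    IsScalarTower.of_algebraMap_eq fun y => rfl
  rw [← classGroupNorm_classGroupNorm (maximalRealSubfield K) (maximalRealSubfield L) L d, hd, map_one]

end BaseChange

/-! ### §2. Corollary 29: `[L : K]` odd ⟹ `h⁻_K ∣ h⁻_L` -/

section OddDegree

variable (K L : Type) [Field K] [NumberField K] [IsCMField K] [Field L] [NumberField L] [IsCMField L]
  [Algebra K L]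

/-- If `c^m ∈ S` and `c^n ∈ S` for coprime `m, n`, then `c ∈ S` (Bézout). [folklore] -/
private theorem mem_of_pow_mem_of_coprime {G : Type*} [CommGroup G] (S : Subgroup G) {c : G} {m n : ℕ}
    (hmn : m.Coprime n) (hm : c ^ m ∈ S) (hn : c ^ n ∈ S) : c ∈ S := by
  have key : c = (c ^ m) ^ m.gcdA n * (c ^ n) ^ m.gcdB n := by
    rw [← zpow_natCast, ← zpow_natCast, ← zpow_mul, ← zpow_mul, ← zpow_add, ← Nat.gcd_eq_gcd_ab,
      Nat.Coprime.gcd_eq_one hmn, Nat.cast_one, zpow_one]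
  rw [key]
  exact mul_mem (S.zpow_mem hm _) (S.zpow_mem hn _)

/-- **`c ∈ ker N_{K/K⁺} ⟹ c^{[L:K]} = N_{L/K}(ι_{L/K} c) ∈ N_{L/K}(ker N_{L/L⁺})`**, every pair of CM fields.
[cite: Okazaki2000, §5 Cor. 29] [cite: NeukirchANT1999, Ch. III §1 Prop. (1.6) (ii)] -/
theorem IsCMField.pow_finrank_mem_map_ker_classGroupNorm {c : ClassGroup (𝓞 K)}
    (hc : c ∈ (classGroupNorm (maximalRealSubfield K) K).ker) :
    c ^ Module.finrank K L ∈ ((classGroupNorm (maximalRealSubfield L) L).ker).map (classGroupNorm K L) :=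
  ⟨classGroupExtend K L c, IsCMField.map_ker_le_ker_classGroupNorm K L ⟨c, hc, rfl⟩,
    classGroupNorm_classGroupExtend K L c⟩

/-- **`[L : K]` odd ⟹ `ker N_{K/K⁺} ⊆ N_{L/K}(ker N_{L/L⁺})`**: `c^{[L:K]}` and `c⁴` (Prop. 27) are both
norms from `ker N_{L/L⁺}`, and `gcd([L:K], 4) = 1`. [cite: Okazaki2000, §5 Prop. 27 and Cor. 29] -/
theorem IsCMField.ker_le_map_ker_classGroupNorm_of_odd (hodd : Odd (Module.finrank K L)) :
    (classGroupNorm (maximalRealSubfield K) K).ker ≤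
      ((classGroupNorm (maximalRealSubfield L) L).ker).map (classGroupNorm K L) := by
  intro c hc
  have hcop : (Module.finrank K L).Coprime 4 := by
    have h := (Nat.coprime_two_right.mpr hodd).pow_right 2
    norm_num at h
    exact h
  exact mem_of_pow_mem_of_coprime _ hcop (IsCMField.pow_finrank_mem_map_ker_classGroupNorm K L hc)
    (IsCMField.pow_four_mem_map_ker_classGroupNorm K L hc)

/-- **`[L : K]` odd ⟹ `N_{L/K}(ker N_{L/L⁺}) = ker N_{K/K⁺}`: the norm map `A_L → A_K` is ONTO** for CM
fields of odd relative degree. [cite: Okazaki2000, §5 Cor. 29] -/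
theorem IsCMField.map_ker_classGroupNorm_eq_ker_of_odd (hodd : Odd (Module.finrank K L)) :
    ((classGroupNorm (maximalRealSubfield L) L).ker).map (classGroupNorm K L) =
      (classGroupNorm (maximalRealSubfield K) K).ker :=
  le_antisymm (IsCMField.map_ker_classGroupNorm_le_ker K L)
    (IsCMField.ker_le_map_ker_classGroupNorm_of_odd K L hodd)

/-- **`[L : K]` odd ⟹ `#ker N_{K/K⁺} ∣ #ker N_{L/L⁺}`**. [cite: Okazaki2000, §5 Cor. 29] -/
theorem IsCMField.card_ker_dvd_card_ker_of_odd_finrank (hodd : Odd (Module.finrank K L)) :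
    Nat.card (classGroupNorm (maximalRealSubfield K) K).ker ∣
      Nat.card (classGroupNorm (maximalRealSubfield L) L).ker :=
  (Subgroup.card_dvd_of_le (IsCMField.ker_le_map_ker_classGroupNorm_of_odd K L hodd)).trans
    (Subgroup.card_map_dvd _ _)

/-- **Okazaki's Corollary 29: for CM fields `K ⊆ L` with `[L : K]` odd, `h⁻_K ∣ h⁻_L`**, i.e.
`h_K/h_{K⁺} ∣ h_L/h_{L⁺}` (exact quotients, `h_{F⁺} ∣ h_F`). [cite: Okazaki2000, §5 Cor. 29] -/
theorem IsCMField.classNumber_div_dvd_classNumber_div_of_odd_finrank (hodd : Odd (Module.finrank K L)) :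
    classNumber K / classNumber (maximalRealSubfield K) ∣
      classNumber L / classNumber (maximalRealSubfield L) := by
  rw [IsCMField.classNumber_div_eq_card_ker, IsCMField.classNumber_div_eq_card_ker]
  exact IsCMField.card_ker_dvd_card_ker_of_odd_finrank K L hodd

/-- Product form of Cor. 29: `[L : K]` odd ⟹ `h_K · h_{L⁺} ∣ h_L · h_{K⁺}`. [cite: Okazaki2000, §5 Cor. 29] -/
theorem IsCMField.classNumber_mul_dvd_classNumber_mul_of_odd_finrank (hodd : Odd (Module.finrank K L)) :
    classNumber K * classNumber (maximalRealSubfield L) ∣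
      classNumber L * classNumber (maximalRealSubfield K) := by
  have hK := IsCMField.card_ker_classGroupNorm_mul_card K
  have hL := IsCMField.card_ker_classGroupNorm_mul_card L
  obtain ⟨t, ht⟩ := IsCMField.card_ker_dvd_card_ker_of_odd_finrank K L hodd
  refine ⟨t, ?_⟩
  unfold classNumber at hK hL ⊢
  rw [← hK, ← hL, ht]
  ring

/-- **«Since `[K : k]` is odd, `N : C_K/ιC_{K⁺} → C_k/ιC_{k⁺}` is surjective by Proposition 27 and class
field theory»** — in the tree's terms: for CM fields `K ⊆ L` with `[L : K]` odd,
`Cl_K = N_{L/K}(Cl_L) · ι(Cl_{K⁺})` (the subgroup `S = N(Cl_L)·ι(Cl_{K⁺})` contains all squares by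
Prop. 27, and `[Cl_K : S] ∣ [Cl_K : N(Cl_L)] ∣ [L : K]` is odd by the norm index theorem).
[cite: Okazaki2000, §5 Prop. 27 and Cor. 29 (proof)] [cite: NeukirchANT1999, Ch. VI §7 Cor. (7.2)] -/
theorem IsCMField.range_sup_range_eq_top_of_odd (hodd : Odd (Module.finrank K L)) :
    (classGroupNorm K L).range ⊔ (classGroupExtend (maximalRealSubfield K) K).range = ⊤ := by
  set S := (classGroupNorm K L).range ⊔ (classGroupExtend (maximalRealSubfield K) K).range with hS
  have hidx : Odd S.index :=
    hodd.of_dvd_nat ((Subgroup.index_dvd_of_le le_sup_left).trans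
      (index_range_classGroupNorm_dvd_finrank K L))
  rw [Subgroup.eq_top_iff']
  intro c
  set q : ClassGroup (𝓞 K) ⧸ S := QuotientGroup.mk c with hq
  have hq2 : q ^ 2 = 1 := by
    rw [hq, ← QuotientGroup.mk_pow, QuotientGroup.eq_one_iff]
    exact IsCMField.sq_mem_range_sup_range K L c
  have h2 : orderOf q ∣ 2 := orderOf_dvd_of_pow_eq_one hq2
  have hS' : orderOf q ∣ S.index := by
    rw [Subgroup.index_eq_card]
    exact orderOf_dvd_natCard q
  have h1 : orderOf q ∣ 1 := by
    rw [← Nat.coprime_two_left.mpr hidx]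
    exact Nat.dvd_gcd h2 hS'
  rw [← QuotientGroup.eq_one_iff, ← hq, ← orderOf_eq_one_iff]
  exact Nat.dvd_one.mp h1

end OddDegree

/-! ### §3. Okazaki's formula (4): `#(C_F/ιC_{F⁺}) · h_{F⁺} = h_F · κ_F` -/

section FormulaFour

variable (F K : Type) [Field F] [NumberField F] [Field K] [NumberField K] [Algebra F K]

/-- For every extension of number fields `F ⊆ K`: **`[Cl_K : ι(Cl_F)] · h_F = h_K · #ker(ι : Cl_F → Cl_K)`**
(Lagrange for `ι(Cl_F) ≤ Cl_K` and for `ker ι ≤ Cl_F`). [cite: Okazaki2000, §5 formula (4)] -/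
theorem index_range_classGroupExtend_mul_classNumber :
    (classGroupExtend F K).range.index * classNumber F =
      classNumber K * Nat.card (classGroupExtend F K).ker := by
  have h1 := (classGroupExtend F K).range.card_mul_index
  have h2 := (classGroupExtend F K).ker.card_mul_index
  rw [Subgroup.index_ker] at h2
  unfold classNumber
  rw [← Nat.card_eq_fintype_card, ← Nat.card_eq_fintype_card, ← h1, ← h2]
  ring

variable [IsCMField K]

/-- **Okazaki's (4): `h⁻_F = #(C_F/ιC_{F⁺})/κ_F`** for a CM field — here as
`[Cl_K : ι(Cl_{K⁺})] = (h_K/h_{K⁺}) · κ_K`, `κ_K = #ker(Cl_{K⁺} → Cl_K)` (`∈ {1, 2}`, tree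
`card_ker_classGroupExtend_le_two`). [cite: Okazaki2000, §5 formula (4)] -/
theorem IsCMField.index_range_classGroupExtend_eq :
    (classGroupExtend (maximalRealSubfield K) K).range.index =
      classNumber K / classNumber (maximalRealSubfield K) *
        Nat.card (classGroupExtend (maximalRealSubfield K) K).ker := by
  have h := index_range_classGroupExtend_mul_classNumber (maximalRealSubfield K) K
  have hpos : 0 < classNumber (maximalRealSubfield K) := by
    unfold classNumber
    exact Fintype.card_pos
  have hmul : classNumber K =
      classNumber K / classNumber (maximalRealSubfield K) * classNumber (maximalRealSubfield K) := by
    rw [IsCMField.classNumber_div_eq_card_ker]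
    unfold classNumber
    rw [← IsCMField.card_ker_classGroupNorm_mul_card K]
  rw [hmul, mul_right_comm] at h
  exact Nat.eq_of_mul_eq_mul_right hpos h

/-- **Okazaki's Lemma 14, first assertion: `κ_F · Q_F ∣ 2`** for a CM field (`κ_F = #ker(C_{F⁺} → C_F)`,
`Q_F` = Hasse's unit index `indexRealUnits`): `κ_F ∈ {1, 2}`, `Q_F ∈ {1, 2}`, and `Q_F = 2 ⇒ κ_F = 1`
(tree `card_ker_classGroupExtend_eq_one_or_two`, `classGroupExtend_injective_of_indexRealUnits_eq_two`;
Washington Thm. 10.3). [cite: Okazaki2000, §3 Lemma 14] [cite: Washington1997, Thm. 10.3] -/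
theorem IsCMField.card_ker_classGroupExtend_mul_indexRealUnits_dvd_two :
    Nat.card (classGroupExtend (maximalRealSubfield K) K).ker * indexRealUnits K ∣ 2 := by
  rcases indexRealUnits_eq_one_or_two K with hQ | hQ
  · rw [hQ, mul_one]
    rcases card_ker_classGroupExtend_eq_one_or_two K with h | h
    · rw [h]; norm_num
    · rw [h]
  · have hbot : (classGroupExtend (maximalRealSubfield K) K).ker = ⊥ :=
      (MonoidHom.ker_eq_bot_iff _).mpr (classGroupExtend_injective_of_indexRealUnits_eq_two K hQ)
    rw [hbot, Subgroup.card_bot, hQ]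

/-- Hence **`h⁻_K ∣ [C_K : ι(C_{K⁺})] ∣ 2 h⁻_K`** ((4) with `κ_K ∈ {1, 2}`).
[cite: Okazaki2000, §3 Lemma 14 and §5 formula (4)] -/
theorem IsCMField.classNumber_div_dvd_index_range_classGroupExtend :
    classNumber K / classNumber (maximalRealSubfield K) ∣
        (classGroupExtend (maximalRealSubfield K) K).range.index ∧
      (classGroupExtend (maximalRealSubfield K) K).range.index ∣
        2 * (classNumber K / classNumber (maximalRealSubfield K)) := by
  rw [IsCMField.index_range_classGroupExtend_eq K]
  refine ⟨Dvd.intro _ rfl, ?_⟩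
  rw [mul_comm 2]
  refine Nat.mul_dvd_mul_left _ ?_
  rcases card_ker_classGroupExtend_eq_one_or_two K with h | h
  · rw [h]; norm_num
  · rw [h]

end FormulaFour


/-! ### §4. Consequences: imaginary quadratic subfields; cyclotomic towers of odd relative degree -/

section Consequences

variable (K L : Type) [Field K] [NumberField K] [IsCMField K] [Field L] [NumberField L] [IsCMField L]
  [Algebra K L]

/-- **An imaginary quadratic field `K` inside a CM field `L` with `[L : K]` odd: `h_K ∣ h⁻_L`** (no
hypothesis on the parity of `h_K`; e.g. `h(ℚ(√−p)) ∣ h⁻(L)` for every CM field `L ⊇ ℚ(√−p)` of odd degree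
over it, such as `ℚ(ζ_p)`, `p ≡ 3 (mod 4)`). [cite: Okazaki2000, §5 Cor. 29 and §1 Cor. 2] -/
theorem IsCMField.classNumber_dvd_classNumber_div_of_finrank_eq_two_of_odd_finrank
    (hK : Module.finrank ℚ K = 2) (hodd : Odd (Module.finrank K L)) :
    classNumber K ∣ classNumber L / classNumber (maximalRealSubfield L) := by
  have h1 : classNumber (maximalRealSubfield K) = 1 := by
    have hf : Module.finrank ℚ (maximalRealSubfield K) = 1 := by
      have h := Module.finrank_mul_finrank ℚ (maximalRealSubfield K) K
      rw [Algebra.IsQuadraticExtension.finrank_eq_two (maximalRealSubfield K) K, hK] at h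
      omega
    have e : maximalRealSubfield K ≃ₐ[ℚ] ℚ :=
      (Subalgebra.topEquiv.symm.trans (Subalgebra.equivOfEq _ _
        (Subalgebra.bot_eq_top_iff_finrank_eq_one.mpr hf).symm)).trans
        (Algebra.botEquiv ℚ (maximalRealSubfield K))
    unfold classNumber
    rw [Fintype.card_congr (ClassGroup.mulEquiv (RingOfIntegers.mapRingEquiv e.toRingEquiv)).toEquiv]
    exact Rat.classNumber_eq
  have h := IsCMField.classNumber_div_dvd_classNumber_div_of_odd_finrank K L hodd
  rwa [IsCMField.classNumber_div_eq_classNumber K h1] at h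

omit [IsCMField K] [IsCMField L] in
/-- **Cyclotomic towers of odd relative degree: `m ∣ n`, `m > 2`, `[ℚ(ζ_n) : ℚ(ζ_m)]` odd ⟹
`h⁻(ℚ(ζ_m)) ∣ h⁻(ℚ(ζ_n))`** (any compatible `ℚ(ζ_m)`-algebra structure on `ℚ(ζ_n)`).
[cite: Okazaki2000, §5 Cor. 29] [cite: Washington1997, Thm. 4.10] -/
theorem classNumber_div_dvd_of_isCyclotomicExtension_of_odd_finrank {m n : ℕ} [NeZero n] (hm : 2 < m)
    (hmn : m ∣ n) [IsCyclotomicExtension {m} ℚ K] [IsCyclotomicExtension {n} ℚ L]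
    (hodd : Odd (Module.finrank K L)) :
    classNumber K / classNumber (maximalRealSubfield K) ∣
      classNumber L / classNumber (maximalRealSubfield L) := by
  have hn : 2 < n := lt_of_lt_of_le hm (Nat.le_of_dvd (Nat.pos_of_ne_zero (NeZero.ne n)) hmn)
  haveI : IsCMField K := IsCyclotomicExtension.Rat.isCMField K (S := ({m} : Set ℕ)) ⟨m, rfl, hm⟩
  haveI : IsCMField L := IsCyclotomicExtension.Rat.isCMField L (S := ({n} : Set ℕ)) ⟨n, rfl, hn⟩
  exact IsCMField.classNumber_div_dvd_classNumber_div_of_odd_finrank K L hodd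

omit [IsCMField K] [IsCMField L] in
/-- **`h⁻(ℚ(ζ_p)) ∣ h⁻(ℚ(ζ_{p^{k+1}}))` for an odd prime `p`**: the relative degree
`φ(p^{k+1})/φ(p) = p^k` is odd. [cite: Okazaki2000, §5 Cor. 29] [cite: Washington1997, Thm. 4.10] -/
theorem classNumber_div_dvd_of_isCyclotomicExtension_prime_pow {p k : ℕ} (hp : p.Prime) (hp2 : p ≠ 2)
    [IsCyclotomicExtension {p} ℚ K] [IsCyclotomicExtension {p ^ (k + 1)} ℚ L] :
    classNumber K / classNumber (maximalRealSubfield K) ∣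
      classNumber L / classNumber (maximalRealSubfield L) := by
  haveI : NeZero (p ^ (k + 1)) := ⟨pow_ne_zero _ hp.ne_zero⟩
  haveI : Fact p.Prime := ⟨hp⟩
  have hp2' : 2 < p := lt_of_le_of_ne hp.two_le (Ne.symm hp2)
  have hKdeg : Module.finrank ℚ K = Nat.totient p :=
    IsCyclotomicExtension.finrank K (Polynomial.cyclotomic.irreducible_rat hp.pos)
  have hLdeg : Module.finrank ℚ L = Nat.totient (p ^ (k + 1)) :=
    IsCyclotomicExtension.finrank L (Polynomial.cyclotomic.irreducible_rat (pow_pos hp.pos _))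
  have hKL : Module.finrank K L = p ^ k := by
    have h := Module.finrank_mul_finrank ℚ K L
    rw [hKdeg, hLdeg, Nat.totient_prime_pow_succ hp, Nat.totient_prime hp] at h
    have hp1 : 0 < p - 1 := by omega
    rw [mul_comm (p ^ k)] at h
    exact Nat.eq_of_mul_eq_mul_left hp1 h
  refine classNumber_div_dvd_of_isCyclotomicExtension_of_odd_finrank K L hp2' (dvd_pow_self p
    (Nat.succ_ne_zero k)) ?_
  rw [hKL]
  exact (hp.odd_of_ne_two hp2).pow

end Consequences

end Literature.NumberTheory.NumberFields

end
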